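import Summits.AtomisticToContinuum.FouriersLaw.Theorems.RobinCoercivity.Negative.Decomposition
import Summits.AtomisticToContinuum.FouriersLaw.Theorems.HonestZwanzigRobinCoercivityPointwise

/-!
# `HonestZwanzig.RobinCoercivity`, line `limit-operator-memory-form`: positive Toeplitz sections (part 1 of 2)

Support file for the crux `stmt-AtomisticToContinuum-12695` (`RobinCoercivity` of route `HonestZwanzig`, sub-problem
`FouriersLaw`), line `limit-operator-memory-form`, registered stub `stub_symbolPositivity` (Q1): the two inputs of the
nonnegativity of the bulk symbol (`Robin.symbol_nonneg_of_bulkLimit`, part 2 `…SymbolNonneg`).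

* Pure analysis (`sum_range_sum_range_sub`, `tendsto_symmetric_partial_sum`, `tsum_nonneg_of_sections`): if every finite
  Toeplitz section of a summable `a : ℤ → ℝ` has nonnegative sum against the all-ones matrix, `Σ_{i,j<M} a(i−j) ≥ 0`,
  then `Σ'_z a(z) ≥ 0` — the section sums are `M ×` the Cesàro means of the symmetric partial sums (Fejér identity), which
  converge (`HasSum.nat_add_neg`, `Filter.Tendsto.cesaro`). Plus the window re-indexing lemmas `sum_window`,
  `sum_sum_window` (`Fin (N+1)` positions `A … A+M−1` ↔ `range M`).
* The chain (`bulk_block_nonneg_pkg`, `bulk_block_nonneg`): at fixed `N ≥ 2` and every `s > 0` the block memory matrix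
  `W_N(s)_{ij} = γT²[i = j contact] − schur_s(g_i∘Θ, g_j)` of the line is positive semidefinite on test vectors vanishing
  at the two contact positions: `vᵀW_N(s)v = schur_s(f_v, f_v) ≥ 0`, `f_v = Σ_i v_i g_i` (odd in `p`), by bilinearity of
  the Schur pairing (`Negative.sum_sum_schur_eq_schur_sum`) and positivity of the orthogonal-dynamics resolvent on the
  diagonal (`Negative.schur_self_nonneg`); the fixed-`N` package is `Robin.stub_feshbachIdentities`.
-/

noncomputable section

open MeasureTheory Finset Matrix Filter Topology
open Literature.MathematicalPhysics.KineticTheory.HeatConduction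
open Summit.AtomisticToContinuum.FouriersLaw.Theses.HonestZwanzig
open Summit.AtomisticToContinuum.FouriersLaw.Theorems.HonestZwanzig.NetworkReduction
open Summit.AtomisticToContinuum.FouriersLaw.Theorems.RobinCoercivity.Negative

namespace Summit.AtomisticToContinuum.FouriersLaw.Theorems.HonestZwanzig.Robin

/-! ### Fejér sums of a summable kernel (pure analysis) -/

/-- The Fejér identity: the `M × M` Toeplitz section of `a : ℤ → ℝ` summed against the all-ones matrix is the sum of
the first `M` symmetric partial sums, `Σ_{i,j<M} a(i−j) = Σ_{m<M} Σ_{|z|≤m} a(z)`. -/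
theorem sum_range_sum_range_sub (a : ℤ → ℝ) (M : ℕ) :
    ∑ i ∈ range M, ∑ j ∈ range M, a ((i : ℤ) - j) =
      ∑ m ∈ range M, ((∑ n ∈ range m, (a ((n : ℤ) + 1) + a (-((n : ℤ) + 1)))) + a 0) := by
  induction M with
  | zero => simp
  | succ M ih =>
    have h1 : ∑ j ∈ range M, a ((M : ℤ) - j) = ∑ n ∈ range M, a ((n : ℤ) + 1) := by
      rw [← Finset.sum_range_reflect (fun n => a ((n : ℤ) + 1)) M]
      refine Finset.sum_congr rfl fun j hj => ?_
      simp only [Finset.mem_range] at hj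
      congr 1
      omega
    have h2 : ∑ i ∈ range M, a ((i : ℤ) - M) = ∑ n ∈ range M, a (-((n : ℤ) + 1)) := by
      rw [← Finset.sum_range_reflect (fun n => a (-((n : ℤ) + 1))) M]
      refine Finset.sum_congr rfl fun i hi => ?_
      simp only [Finset.mem_range] at hi
      congr 1
      omega
    have h3 : ∀ i ∈ range M, ∑ j ∈ range (M + 1), a ((i : ℤ) - j) =
        ∑ j ∈ range M, a ((i : ℤ) - j) + a ((i : ℤ) - M) := fun i _ => Finset.sum_range_succ _ M
    rw [Finset.sum_range_succ (fun m => (∑ n ∈ range m, (a ((n : ℤ) + 1) + a (-((n : ℤ) + 1)))) + a 0) M, ← ih,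
      Finset.sum_range_succ (fun i => ∑ j ∈ range (M + 1), a ((i : ℤ) - j)) M, Finset.sum_congr rfl h3,
      Finset.sum_add_distrib (f := fun i : ℕ => ∑ j ∈ range M, a ((i : ℤ) - j)) (g := fun i : ℕ => a ((i : ℤ) - M)),
      Finset.sum_range_succ (fun j => a ((M : ℤ) - j)) M, h1, h2, sub_self,
      Finset.sum_add_distrib (f := fun n : ℕ => a ((n : ℤ) + 1)) (g := fun n : ℕ => a (-((n : ℤ) + 1)))]
    ring

/-- The symmetric partial sums `Σ_{|z| ≤ m} a(z)` of a summable `a : ℤ → ℝ` converge to `Σ'_z a(z)`. -/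
theorem tendsto_symmetric_partial_sum (a : ℤ → ℝ) (ha : Summable a) :
    Tendsto (fun m : ℕ => (∑ n ∈ range m, (a ((n : ℤ) + 1) + a (-((n : ℤ) + 1)))) + a 0) atTop
      (𝓝 (∑' z, a z)) := by
  have h1 := (ha.hasSum.nat_add_neg).tendsto_sum_nat
  have h2 := (h1.comp (tendsto_add_atTop_nat 1)).sub_const (a 0)
  rw [add_sub_cancel_right] at h2
  refine h2.congr fun m => ?_
  simp only [Function.comp_apply, Finset.sum_range_succ']
  push_cast
  ring

/-- **Toeplitz–Herglotz positivity.** If every finite Toeplitz section of a summable `a : ℤ → ℝ` has nonnegative sum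
against the all-ones matrix, `Σ_{i,j<M} a(i−j) ≥ 0`, then `Σ'_z a(z) ≥ 0` (Cesàro means of the symmetric partial sums). -/
theorem tsum_nonneg_of_sections (a : ℤ → ℝ) (ha : Summable a)
    (hpos : ∀ M : ℕ, 0 ≤ ∑ i ∈ range M, ∑ j ∈ range M, a ((i : ℤ) - j)) : 0 ≤ ∑' z, a z := by
  have hlim := (tendsto_symmetric_partial_sum a ha).cesaro
  refine ge_of_tendsto' hlim fun M => ?_
  rw [← sum_range_sum_range_sub]
  exact mul_nonneg (inv_nonneg.2 (Nat.cast_nonneg M)) (hpos M)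

/-- Re-indexing a window of `M` consecutive positions `A, …, A+M−1` of `Fin (N+1)` by `range M`. -/
theorem sum_window {N A M : ℕ} (hAM : A + M ≤ N + 1) (F : ℕ → ℝ) :
    ∑ i : Fin (N + 1), (if A ≤ i.val ∧ i.val < A + M then F i.val else 0) = ∑ k ∈ range M, F (A + k) := by
  set f : ℕ → ℝ := fun n => if A ≤ n ∧ n < A + M then F n else 0 with hf
  have h0 : (∑ i : Fin (N + 1), (if A ≤ i.val ∧ i.val < A + M then F i.val else 0)) =
      ∑ i : Fin (N + 1), f i.val := rfl
  rw [h0, Fin.sum_univ_eq_sum_range f (N + 1), hf, ← Finset.sum_filter]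
  have hI : (range (N + 1)).filter (fun n => A ≤ n ∧ n < A + M) = Finset.Ico A (A + M) := by
    ext n
    simp only [Finset.mem_filter, Finset.mem_range, Finset.mem_Ico]
    omega
  rw [hI, Finset.sum_Ico_eq_sum_range, Nat.add_sub_cancel_left]

/-- Double-sum version of `sum_window` for a product of two window indicators. -/
theorem sum_sum_window {N A M : ℕ} (hAM : A + M ≤ N + 1) (Φ : ℕ → ℕ → ℝ) :
    ∑ i : Fin (N + 1), ∑ j : Fin (N + 1), (if A ≤ i.val ∧ i.val < A + M then (1 : ℝ) else 0) *
        (if A ≤ j.val ∧ j.val < A + M then (1 : ℝ) else 0) * Φ i.val j.val =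
      ∑ a ∈ range M, ∑ b ∈ range M, Φ (A + a) (A + b) := by
  have inner : ∀ i : Fin (N + 1), ∑ j : Fin (N + 1), (if A ≤ i.val ∧ i.val < A + M then (1 : ℝ) else 0) *
      (if A ≤ j.val ∧ j.val < A + M then (1 : ℝ) else 0) * Φ i.val j.val =
      if A ≤ i.val ∧ i.val < A + M then (∑ b ∈ range M, Φ i.val (A + b)) else 0 := by
    intro i
    split_ifs with hi
    · rw [← sum_window hAM (fun m => Φ i.val m)]
      refine Finset.sum_congr rfl fun j _ => ?_
      split_ifs <;> simp
    · exact Finset.sum_eq_zero fun j _ => by simp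
  rw [Finset.sum_congr rfl fun i _ => inner i]
  exact sum_window hAM (fun n => ∑ b ∈ range M, Φ n (A + b))

/-! ### The bond block of the block memory matrix is positive semidefinite (fixed `N`, fixed `s > 0`) -/

section FixedN

variable {ω₂ lam β γ : ℝ} {N : ℕ} {T : ℝ}
  {Adm : (PhaseSpace N → ℝ) → Prop}
  {corr : (PhaseSpace N → ℝ) → (PhaseSpace N → ℝ) → ℝ → ℝ}
  {lap : ℝ → (PhaseSpace N → ℝ) → (PhaseSpace N → ℝ) → ℝ}
  {cov : (PhaseSpace N → ℝ) → (PhaseSpace N → ℝ) → ℝ}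
  {e : Fin N → PhaseSpace N → ℝ}
  (hAdm : ∀ f, Adm f ↔ (Continuous f ∧ ∃ A : ℝ, ∀ z,
    |f z| ≤ A * Real.exp ((pinnedChain ω₂ lam β γ).hamiltonian N z / (8 * T))))
  (hcorr : ∀ f g t, corr f g t =
    (∫ z, f z * (∫ y, g y ∂((pinnedChain ω₂ lam β γ).transitionKernel N T T t.toNNReal z))
      ∂(pinnedChain ω₂ lam β γ).gibbsMeasure N T) -
    (∫ z, f z ∂(pinnedChain ω₂ lam β γ).gibbsMeasure N T) *
      (∫ z, g z ∂(pinnedChain ω₂ lam β γ).gibbsMeasure N T))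
  (hlap : ∀ s f g, lap s f g = ∫ t in Set.Ioi (0 : ℝ), Real.exp (-(s * t)) * corr f g t)
  (he : ∀ x z, e x z = z.2 x ^ 2 / 2 + (pinnedChain ω₂ lam β γ).U (z.1 x) +
    ∑ j : Fin N, ((if j.val = x.val + 1 then (pinnedChain ω₂ lam β γ).V (z.1 j - z.1 x) / 2 else 0) +
      (if x.val = j.val + 1 then (pinnedChain ω₂ lam β γ).V (z.1 x - z.1 j) / 2 else 0)))
  (hFI : ∀ f g : PhaseSpace N → ℝ, Adm f → Adm g →
    Integrable f ((pinnedChain ω₂ lam β γ).gibbsMeasure N T) ∧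
    (∀ t : ℝ, 0 ≤ t → Integrable (fun z => f z *
      (∫ y, g y ∂((pinnedChain ω₂ lam β γ).transitionKernel N T T t.toNNReal z)))
      ((pinnedChain ω₂ lam β γ).gibbsMeasure N T)) ∧
    IntegrableOn (corr f g) (Set.Ioi 0) ∧
    (∀ t : ℝ, 0 ≤ t → corr f g t = corr (fun z => g (z.1, -z.2)) (fun z => f (z.1, -z.2)) t) ∧
    (∀ s : ℝ, 0 < s → ∀ x : Fin N,
      s * lap s (e x) g - cov (e x) g =
        lap s (fun z => (pinnedChain ω₂ lam β γ).generator N T T (e x) (z.1, -z.2)) g ∧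
      s * lap s f (e x) - cov f (e x) = lap s f ((pinnedChain ω₂ lam β γ).generator N T T (e x))))
  (hω : 0 < ω₂) (hl : 0 ≤ lam) (hβ : 0 ≤ β) (hT : 0 < T)

include hAdm hcorr hlap he hFI hω hl hβ hT in
/-- **The bond block of `W_N(s)` is positive semidefinite** (abstract gadgets of the fixed-`N` package, `s > 0`,
`G = G(s)` with positive quadratic form): for the position observables `g_i` (bond current `j_{i−1}` at a bond
position, bath observable at a contact) and `W_{ij} = γT²[i = j contact] − schur_s(g_i∘Θ, g_j)`, every `v` vanishing at
the two contact positions `0, N` has `Σ_{i,j} v_i W_{ij} v_j = schur_s(f_v, f_v) ≥ 0`, `f_v = Σ_i v_i g_i` (odd in `p`). -/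
theorem bulk_block_nonneg_pkg (hβ' : 0 < β) (hγ' : 0 < γ) (hN : 2 ≤ N) {s : ℝ} (hs : 0 < s)
    (G : Matrix (Fin N) (Fin N) ℝ) (hG : ∀ x y, G x y = lap s (e x) (e y))
    (hGp : ∀ v : Fin N → ℝ, v ≠ 0 → 0 < ∑ x, ∑ y, v x * G x y * v y)
    (schur : (PhaseSpace N → ℝ) → (PhaseSpace N → ℝ) → ℝ)
    (hschur : ∀ f g, schur f g = lap s f g - ∑ u, ∑ v, lap s f (e u) * G⁻¹ u v * lap s (e v) g)
    (g : Fin (N + 1) → PhaseSpace N → ℝ)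
    (hg : ∀ i z, g i z = (∑ b : Fin N, if b.val + 1 = i.val then (pinnedChain ω₂ lam β γ).bondCurrent N b z else 0) +
      (∑ x : Fin N, if (i.val = 0 ∧ x.val = 0) ∨ (i.val = N ∧ x.val + 1 = N) then
        (pinnedChain ω₂ lam β γ).γ * (T - z.2 x ^ 2) else 0))
    (W : Fin (N + 1) → Fin (N + 1) → ℝ)
    (hW : ∀ i j, W i j = (if i = j ∧ (i.val = 0 ∨ i.val = N) then (pinnedChain ω₂ lam β γ).γ * T ^ 2 else 0) -
      schur (fun z => g i (z.1, -z.2)) (g j))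
    (v : Fin (N + 1) → ℝ) (hv : ∀ i : Fin (N + 1), i.val = 0 ∨ i.val = N → v i = 0) :
    0 ≤ ∑ i, ∑ j, v i * W i j * v j := by
  have hN0 : 0 < N := by omega
  -- admissibility and parity of the position observables
  have hg_adm : ∀ i, Adm (g i) := by
    intro i
    refine adm_of_eq Adm (hg i) (adm_add Adm hAdm ?_ ?_)
    · refine adm_sum Adm hAdm Finset.univ _ (adm_const Adm hAdm hω hl hβ hT 0) fun b _ => ?_
      exact adm_ite Adm _ (adm_bondCurrent Adm hAdm hω hl hβ hT b) (adm_const Adm hAdm hω hl hβ hT 0)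
    · refine adm_sum Adm hAdm Finset.univ _ (adm_const Adm hAdm hω hl hβ hT 0) fun x _ => ?_
      exact adm_ite Adm _ (adm_const_mul Adm hAdm _ (adm_sub Adm hAdm (adm_const Adm hAdm hω hl hβ hT T)
        (adm_psq Adm hAdm hω hl hβ hT x))) (adm_const Adm hAdm hω hl hβ hT 0)
  have hgr_adm : ∀ i, Adm (fun z => g i (z.1, -z.2)) := fun i => adm_rev Adm hAdm (hg_adm i)
  have hg_odd : ∀ i : Fin (N + 1), ¬ (i.val = 0 ∨ i.val = N) → ∀ z, g i (z.1, -z.2) = -g i z := by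
    intro i hi z
    have hb : ∀ w, g i w = ∑ b : Fin N, if b.val + 1 = i.val then (pinnedChain ω₂ lam β γ).bondCurrent N b w else 0 := by
      intro w
      rw [hg i w]
      have : ∀ x : Fin N, ¬ ((i.val = 0 ∧ x.val = 0) ∨ (i.val = N ∧ x.val + 1 = N)) := fun x h => by omega
      simp only [this, if_false, Finset.sum_const_zero, add_zero]
    rw [hb, hb, ← Finset.sum_neg_distrib]
    refine Finset.sum_congr rfl fun b _ => ?_
    split_ifs
    · exact OscillatorChain.bondCurrent_neg_momentum _ N b z
    · simp
  -- the odd combination `f_v`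
  set f : PhaseSpace N → ℝ := fun z => ∑ j, v j * g j z with hf
  have hf_adm : Adm f := adm_sum Adm hAdm Finset.univ _ (adm_const Adm hAdm hω hl hβ hT 0)
    fun j _ => adm_const_mul Adm hAdm _ (hg_adm j)
  have hfr : (fun z => ∑ i, v i * g i (z.1, -z.2)) = fun z => (-1 : ℝ) * f z := by
    funext z
    rw [hf]
    simp only [neg_mul, one_mul, ← Finset.sum_neg_distrib]
    refine Finset.sum_congr rfl fun i _ => ?_
    by_cases hi : i.val = 0 ∨ i.val = N
    · simp [hv i hi]
    · rw [hg_odd i hi z]; ring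
  -- termwise: `v_i W_ij v_j = - schur(v_i g_i∘Θ, v_j g_j)` (the contact diagonal carries `v_i = 0`)
  have hterm : ∀ i j, v i * W i j * v j = -schur (fun z => v i * g i (z.1, -z.2)) (fun z => v j * g j z) := by
    intro i j
    rw [hW, schur_const_mul_left' hcorr hlap s G schur hschur, schur_const_mul_right' hcorr hlap s G schur hschur]
    by_cases h : i = j ∧ (i.val = 0 ∨ i.val = N)
    · rw [if_pos h, hv i h.2]; ring
    · rw [if_neg h]; ring
  have hsum : ∑ i, ∑ j, v i * W i j * v j = schur f f := by
    simp only [hterm, Finset.sum_neg_distrib]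
    rw [sum_sum_schur_eq_schur_sum hAdm hcorr hlap he hFI hω hl hβ hT hs.le G schur hschur Finset.univ Finset.univ
      (fun i z => v i * g i (z.1, -z.2)) (fun j z => v j * g j z)
      (fun i _ => adm_const_mul Adm hAdm _ (hgr_adm i)) (fun j _ => adm_const_mul Adm hAdm _ (hg_adm j))]
    rw [hfr, schur_const_mul_left' hcorr hlap s G schur hschur]
    ring
  rw [hsum]
  exact schur_self_nonneg hAdm hcorr hlap he hFI hω hl hβ hT hβ' hγ' hN0 hs G hG hGp schur hschur hf_adm

end FixedN

/-- **The bond block of `W_N(s)` is positive semidefinite**, for the canonical objects of the route at fixed `N ≥ 2` and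
every `s > 0` (gadgets `lap, e, G, schur, g, W` with their defining equations, as in the line's stubs): every test
vector `v` on the `N + 1` positions vanishing at the two contacts has `vᵀ W_N(s) v ≥ 0`. -/
theorem bulk_block_nonneg {ω₂ lam β γ T : ℝ} (hω : 0 < ω₂) (hl : 0 < lam) (hβ : 0 < β) (hγ : 0 < γ) (hT : 0 < T)
    {N : ℕ} (hN : 2 ≤ N)
    (lap : ℝ → (PhaseSpace N → ℝ) → (PhaseSpace N → ℝ) → ℝ) (e : Fin N → PhaseSpace N → ℝ)
    (G : ℝ → Matrix (Fin N) (Fin N) ℝ) (schur : ℝ → (PhaseSpace N → ℝ) → (PhaseSpace N → ℝ) → ℝ)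
    (g : Fin (N + 1) → PhaseSpace N → ℝ) (W : ℝ → Fin (N + 1) → Fin (N + 1) → ℝ)
    (hlap : ∀ s f₁ f₂, lap s f₁ f₂ = ∫ t in Set.Ioi (0 : ℝ), Real.exp (-(s * t)) *
      ((∫ z, f₁ z * (∫ y, f₂ y ∂((pinnedChain ω₂ lam β γ).transitionKernel N T T t.toNNReal z))
          ∂(pinnedChain ω₂ lam β γ).gibbsMeasure N T) -
        (∫ z, f₁ z ∂(pinnedChain ω₂ lam β γ).gibbsMeasure N T) *
          (∫ z, f₂ z ∂(pinnedChain ω₂ lam β γ).gibbsMeasure N T)))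
    (he : ∀ x z, e x z = z.2 x ^ 2 / 2 + (pinnedChain ω₂ lam β γ).U (z.1 x) +
      ∑ j : Fin N, ((if j.val = x.val + 1 then (pinnedChain ω₂ lam β γ).V (z.1 j - z.1 x) / 2 else 0) +
        (if x.val = j.val + 1 then (pinnedChain ω₂ lam β γ).V (z.1 x - z.1 j) / 2 else 0)))
    (hG : ∀ s, G s = Matrix.of fun x y => lap s (e x) (e y))
    (hschur : ∀ s f₁ f₂, schur s f₁ f₂ = lap s f₁ f₂ - ∑ x, ∑ y, lap s f₁ (e x) * (G s)⁻¹ x y * lap s (e y) f₂)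
    (hg : ∀ i z, g i z = (∑ b : Fin N, if b.val + 1 = i.val then (pinnedChain ω₂ lam β γ).bondCurrent N b z else 0) +
      (∑ x : Fin N, if (i.val = 0 ∧ x.val = 0) ∨ (i.val = N ∧ x.val + 1 = N) then
        (pinnedChain ω₂ lam β γ).γ * (T - z.2 x ^ 2) else 0))
    (hW : ∀ s i j, W s i j = (if i = j ∧ (i.val = 0 ∨ i.val = N) then (pinnedChain ω₂ lam β γ).γ * T ^ 2 else 0) -
      schur s (fun z => g i (z.1, -z.2)) (g j))
    {s : ℝ} (hs : 0 < s) (v : Fin (N + 1) → ℝ) (hv : ∀ i : Fin (N + 1), i.val = 0 ∨ i.val = N → v i = 0) :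
    0 ≤ ∑ i, ∑ j, v i * W s i j * v j := by
  obtain rfl : lap = fun s f g => ∫ t in Set.Ioi (0 : ℝ), Real.exp (-(s * t)) *
      ((∫ z, f z * (∫ y, g y ∂((pinnedChain ω₂ lam β γ).transitionKernel N T T t.toNNReal z))
          ∂(pinnedChain ω₂ lam β γ).gibbsMeasure N T) -
        (∫ z, f z ∂(pinnedChain ω₂ lam β γ).gibbsMeasure N T) *
          (∫ z, g z ∂(pinnedChain ω₂ lam β γ).gibbsMeasure N T)) :=
    funext fun s => funext fun f => funext fun g => hlap s f g
  obtain rfl : e = fun x z => z.2 x ^ 2 / 2 + (pinnedChain ω₂ lam β γ).U (z.1 x) +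
      ∑ j : Fin N, ((if j.val = x.val + 1 then (pinnedChain ω₂ lam β γ).V (z.1 j - z.1 x) / 2 else 0) +
        (if x.val = j.val + 1 then (pinnedChain ω₂ lam β γ).V (z.1 x - z.1 j) / 2 else 0)) :=
    funext fun x => funext fun z => he x z
  obtain ⟨-, hFI2, -, hGp⟩ := stub_feshbachIdentities ω₂ lam β γ hω hl hβ hγ T hT N hN
  have hGs : ∀ x y, G s x y = (fun s f g => ∫ t in Set.Ioi (0 : ℝ), Real.exp (-(s * t)) *
      ((∫ z, f z * (∫ y, g y ∂((pinnedChain ω₂ lam β γ).transitionKernel N T T t.toNNReal z))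
          ∂(pinnedChain ω₂ lam β γ).gibbsMeasure N T) -
        (∫ z, f z ∂(pinnedChain ω₂ lam β γ).gibbsMeasure N T) *
          (∫ z, g z ∂(pinnedChain ω₂ lam β γ).gibbsMeasure N T))) s
      ((fun x z => z.2 x ^ 2 / 2 + (pinnedChain ω₂ lam β γ).U (z.1 x) +
      ∑ j : Fin N, ((if j.val = x.val + 1 then (pinnedChain ω₂ lam β γ).V (z.1 j - z.1 x) / 2 else 0) +
        (if x.val = j.val + 1 then (pinnedChain ω₂ lam β γ).V (z.1 x - z.1 j) / 2 else 0))) x)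
      ((fun x z => z.2 x ^ 2 / 2 + (pinnedChain ω₂ lam β γ).U (z.1 x) +
      ∑ j : Fin N, ((if j.val = x.val + 1 then (pinnedChain ω₂ lam β γ).V (z.1 j - z.1 x) / 2 else 0) +
        (if x.val = j.val + 1 then (pinnedChain ω₂ lam β γ).V (z.1 x - z.1 j) / 2 else 0))) y) := by
    intro x y; rw [hG]; rfl
  have hGp' : ∀ w : Fin N → ℝ, w ≠ 0 → 0 < ∑ x, ∑ y, w x * G s x y * w y := by
    intro w hw
    have h := hGp s hs w hw
    simp only [Matrix.of_apply] at h
    simp only [hG, Matrix.of_apply]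
    exact h
  exact bulk_block_nonneg_pkg (ω₂ := ω₂) (lam := lam) (β := β) (γ := γ) (N := N) (T := T)
    (corr := fun f g t => (∫ z, f z * (∫ y, g y ∂((pinnedChain ω₂ lam β γ).transitionKernel N T T
      t.toNNReal z)) ∂(pinnedChain ω₂ lam β γ).gibbsMeasure N T) -
      (∫ z, f z ∂(pinnedChain ω₂ lam β γ).gibbsMeasure N T) * (∫ z, g z ∂(pinnedChain ω₂ lam β γ).gibbsMeasure N T))
    (cov := fun f g => (∫ z, f z * g z ∂(pinnedChain ω₂ lam β γ).gibbsMeasure N T) -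
      (∫ z, f z ∂(pinnedChain ω₂ lam β γ).gibbsMeasure N T) * (∫ z, g z ∂(pinnedChain ω₂ lam β γ).gibbsMeasure N T))
    (fun f => Iff.rfl) (fun f g t => rfl) (fun s f g => rfl) (fun x z => rfl) hFI2 hω hl.le hβ.le hT hβ hγ hN hs
    (G s) hGs hGp' (schur s) (fun f₁ f₂ => hschur s f₁ f₂) g hg (W s) (fun i j => hW s i j) v hv

end Summit.AtomisticToContinuum.FouriersLaw.Theorems.HonestZwanzig.Robin

end
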